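import Literature.NumberTheory.EllipticCurves.HeegnerPointsKolyvaginPrimaryPairingProofs

/-!
# Route `GenusKolyvaginAtTwo`, LINE 6 of crux `KolyvaginExactAtTwo`: Q5 `EquivariantChebotarevAtTwo`
# — the two `p = 2` ingredients of McCallum's Cor. 3.2 for `τ`-STABLE families
# (helper, PROVED; seat `bsd-line-gk2-p2` g5, cell `bsd-f1-sign2`)

Item stmt-BirchSwinnertonDyer-24881 (Q5) is McCallum 1991 Cor. 3.2 with `p := 2` on `Δ(E) < 0`, the
eigenclass hypothesis `c·c_i = ±c_i` (meaningless at `2`) replaced by `τ`-STABILITY of the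
independent family (`c·c_i = c_{π i}`, local orders constant on `τ`-orbits) and the family required
to meet the inflation kernel `H¹(K(E[2^M])/K, E[2^M])` trivially. The tree PROVES the odd-`p`
statement from the Čebotarev density theorem (`exists_kolyvaginPrime_gt_pow`,
`HeegnerPointsKolyvaginPrimaryCebotarevProofs`); `p ≠ 2` enters there at exactly two places, and this
file supplies the `p = 2` replacements of both (pure algebra / the tree's pairing, no `sorry`):

* §1 `exists_h1Eval_eq_of_indep_of_res` — **joint surjectivity of the evaluations** (McCallum (2) /
  Gross Prop. 9.3 at level `n`): the tree's `exists_h1Eval_eq_of_indep` VERBATIM with its two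
  `p`-odd inputs `hz` (`−1 ∈ ρ̄(Γ_K)`) and `hu` (`2 ∈ (ℤ/n)^×`) — used there only to make
  restriction to `Γ_{K(E[n])}` injective on the span (Gross Prop. 9.1, `H¹(K(E[n])/K, E[n]) = 0`,
  FALSE at `2`: Lawson–Wuthrich) — REPLACED by that injectivity as a hypothesis (`hres`), which is
  exactly the extra binder of Q5. Valid for every prime `p`.
* §2 `exists_orders_of_tauStable` — **Step B at `2`: prescribing the local orders on a `τ`-stable
  family.** For an abelian group `T` with an additive involution `τ` and a point `P` such that
  `a P + b τP = 0 ⟹ 2^M ∣ a, b` (`E[2^M]` free of rank one over `R_M = ℤ/2^M[τ]` — the conclusion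
  of Q1 `CyclicTorsionOfNegDisc` with `#E[2^M] = 4^M`), an involution `π` of a finite index set and
  exponents `N i ≤ e i ≤ M` constant on `π`-orbits, there is `x : ι → T` with `2^{e i} x_i = 0` and
  **`τ(x_{π i}) + x_i` of order EXACTLY `2^{N i}`** for all `i` — the value `[c_i, ρ^τ ρ] =
  τ[c_{π i}, ρ] + [c_i, ρ]` that the Frobenius `(τρ)²` of a Kolyvagin prime produces (McCallum's
  proof of Cor. 3.2; at odd `p` the tree's `IsLiftOfAut.exists_h1Eval_conj_mul_order` uses
  `±`-eigenvectors and `[c_i, ρ^τρ] = 2[c_i, ρ]`, which needs `2` invertible). Choice: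
  `x_i = 2^{M − N_i} P` on one point of each `π`-orbit, `0` on the other; there is NO index loss.

What remains of Q5 after this file is the odd-`p` Čebotarev bookkeeping of
`exists_kolyvaginPrime_gt_pow` (Frobenius in `c₀ · res(ρ𝒩)` by density — named fact
`Automorphic.chebotarev_artinRep` —, inertness, the local criterion (3) at `λ`, `E[2]` simple with
scalar commutant from `ρ̄_{E,2}(Γ_K) = GL₂(𝔽₂)`), with §1/§2 in place of its two `p`-odd steps.
CAVEAT for the planner (not used here): Q5 as typed has no binder excluding `K = ℚ(√Δ_E)`; there
`ρ̄_{E,2}(Γ_K) = A₃` and `End_{Γ_K}(E[2]) = 𝔽₄`, so the scalar-commutant input `hC` of §1 is not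
available on that sub-case. BSD is not proved by this; Q5 is not closed by this file.

References: [McCallumLMS1991] §3 (2), Prop. 3.1, Cor. 3.2 (pp. 279–280); [GrossLMS1991] §9 Prop.
9.1, 9.3; [LawsonWuthrich2016] (the inflated class at `2`).
-/

set_option autoImplicit false
set_option linter.dupNamespace false

noncomputable section

open scoped Classical

namespace Summit.BirchSwinnertonDyer.BirchSwinnertonDyer.Theorems.GenusExact

open WeierstrassCurve Field Finset
open Literature.NumberTheory.EllipticCurves

universe u

/-! ### §1 Joint surjectivity of the evaluations, from injectivity of restriction on the span -/

section JointImage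

variable {K : Type u} [Field K] (W : WeierstrassCurve K)

/-- **McCallum (2) / Gross Prop. 9.3 at level `n`, at every `p` (so `p = 2`).** For classes
`x_i ∈ H¹(K, E[n])` (`p ∣ n`) killed by `p^{eᵢ}` and independent (`∑ aᵢxᵢ = 0 ⟹ p^{eᵢ} ∣ aᵢ`),
`E[p]` a simple `Γ_K`-module with scalar commutant, and restriction to `Γ_{K(E[n])}` injective on the
span (`hres`: if `[∑ aᵢxᵢ, ρ] = 0` for all `ρ ∈ Γ_{K(E[n])}` then `∑ aᵢxᵢ = 0` — the binder of Q5;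
at odd `p` it is Gross's Prop. 9.1), every `t ∈ ∏ E[n][p^{eᵢ}]` is `([x_i, ρ])_i` for some
`ρ ∈ Γ_{K(E[n])}`. [cite: McCallumLMS1991, §3 (2)] [cite: GrossLMS1991, Prop. 9.3] -/
theorem exists_h1Eval_eq_of_indep_of_res {p : ℕ} (hp : p.Prime) {n : ℤ} (hpn : (p : ℤ) ∣ n)
    (hS : ∀ H : AddSubgroup (geomTorsion W p),
      (∀ g : absoluteGaloisGroup K, ∀ t ∈ H, g • t ∈ H) → H = ⊥ ∨ H = ⊤)
    (hC : ∀ f : geomTorsion W p →+ geomTorsion W p,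
      (∀ (g : absoluteGaloisGroup K) (t : geomTorsion W p), f (g • t) = g • f t) →
        ∃ k : ℤ, ∀ t, f t = k • t)
    {ι : Type*} [Fintype ι] (xs : ι → galH1Torsion W n) (e : ι → ℕ)
    (he : ∀ i, ((p : ℤ) ^ e i) • xs i = 0)
    (hind : ∀ a : ι → ℤ, ∑ i, a i • xs i = 0 → ∀ i, ((p : ℤ) ^ e i) ∣ a i)
    (hres : ∀ a : ι → ℤ, (∀ ρ ∈ torsionFixing W n, h1Eval W n (∑ i, a i • xs i) ρ = 0) →
      ∑ i, a i • xs i = 0)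
    (t : ι → geomTorsion W n) (ht : ∀ i, ((p : ℤ) ^ e i) • t i = 0) :
    ∃ ρ ∈ torsionFixing W n, ∀ i, h1Eval W n (xs i) ρ = t i := by
  set ι₁ : geomTorsion W p →+ geomTorsion W n :=
    AddSubgroup.inclusion (W.geomTorsion_le_of_dvd hpn) with hι₁
  have hιG : ∀ (g : absoluteGaloisGroup K) (s : geomTorsion W p), ι₁ (g • s) = g • ι₁ s :=
    fun _ _ ↦ rfl
  have hrange : ∀ s : geomTorsion W n, (p : ℤ) • s = 0 → ∃ s₁, ι₁ s₁ = s := fun s hs ↦ by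
    refine ⟨⟨(s : geomPoints W), ?_⟩, rfl⟩
    rw [mem_geomTorsion_iff]
    have := congrArg (fun x : geomTorsion W n ↦ (x : geomPoints W)) hs
    simpa using this
  have hfull := KolyvaginPairing.eq_piTors_of_stable_of_indep hp hS hC ι₁ hιG hrange
    (Finset.univ.sup e) (fun i ↦ Finset.le_sup (Finset.mem_univ i)) (jointRangeN W n xs)
    (fun g m hm ↦ smul_mem_jointRangeN W n xs g hm) (fun m hm i ↦ ?_) (fun a ha ↦ ?_)
  · have : t ∈ jointRangeN W n xs := by rw [hfull]; exact ht
    exact this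
  · obtain ⟨ρ, hρ, hm⟩ := hm
    rw [← hm i, ← h1Eval_zsmul W n _ _ hρ, he i, h1Eval_zero W n hρ]
  · refine hind a (hres a fun ρ hρ ↦ ?_)
    rw [h1Eval_sum W n _ _ hρ]
    simp only [h1Eval_zsmul W n _ _ hρ]
    exact ha _ ⟨ρ, hρ, fun i ↦ rfl⟩

end JointImage

/-! ### §2 Step B at `2`: prescribed orders of `τ x_{π i} + x_i` on a `τ`-stable family -/

section StepB

variable {T : Type*} [AddCommGroup T]

/-- Exact order `2^N` of `2^{M−N} Q` when `Q` has "`2`-adic order `2^M`" in the sense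
`2^{M-1} Q ≠ 0`, `2^M Q = 0`. [folklore] -/
theorem zsmul_pow_sub_order {M N : ℕ} (hN : N ≤ M) {Q : T} (hM : (2 : ℤ) ^ M • Q = 0)
    (hM1 : N ≠ 0 → (2 : ℤ) ^ (M - 1) • Q ≠ 0) :
    (2 : ℤ) ^ N • ((2 : ℤ) ^ (M - N) • Q) = 0 ∧
      (N ≠ 0 → (2 : ℤ) ^ (N - 1) • ((2 : ℤ) ^ (M - N) • Q) ≠ 0) := by
  constructor
  · rw [smul_smul, ← pow_add, Nat.add_sub_cancel' hN, hM]
  · intro hN0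
    rw [smul_smul, ← pow_add, show N - 1 + (M - N) = M - 1 by omega]
    exact hM1 hN0

/-- **Step B of McCallum's Cor. 3.2 at `p = 2` for a `τ`-stable family.** Let `τ` be an additive
endomorphism of `T` (the involution of complex conjugation; involutivity is not used) and `P ∈ T` with `2^M P = 0` and `a P + b τP = 0 ⟹ 2^M ∣ a ∧ 2^M ∣ b`
(`E[2^M] = R_M · P` free of rank one over `R_M = ℤ/2^M[τ]`, Q1 on `Δ(E) < 0`); let `π` be an
involution of a finite index set with exponents `N i ≤ e i ≤ M`, `N (π i) = N i`. Then there is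
`x : ι → T` with `2^{e i} x_i = 0` and `τ(x_{π i}) + x_i` of order exactly `2^{N i}`
(`2^{N i}` kills it, `2^{N i − 1}` does not when `N i ≠ 0`), for every `i`. These are the values
`[c_i, ρ^τ ρ] = τ[c_{π i}, ρ] + [c_i, ρ]` at the Frobenius `(τρ)²` of McCallum's proof when
`[c_j, ρ] = x_j`. [cite: McCallumLMS1991, Prop. 3.1, Cor. 3.2 (proof)] -/
theorem exists_orders_of_tauStable (τ : T →+ T) {M : ℕ} {P : T}
    (hPM : (2 : ℤ) ^ M • P = 0)
    (hfree : ∀ a b : ℤ, a • P + b • τ P = 0 → (2 : ℤ) ^ M ∣ a ∧ (2 : ℤ) ^ M ∣ b)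
    {ι : Type*} [Fintype ι] (π : ι → ι) (hπ : ∀ i, π (π i) = i)
    (e N : ι → ℕ) (hNe : ∀ i, N i ≤ e i) (heM : ∀ i, e i ≤ M) (hNπ : ∀ i, N (π i) = N i) :
    ∃ x : ι → T, (∀ i, (2 : ℤ) ^ e i • x i = 0) ∧
      ∀ i, (2 : ℤ) ^ N i • (τ (x (π i)) + x i) = 0 ∧
        (N i ≠ 0 → (2 : ℤ) ^ (N i - 1) • (τ (x (π i)) + x i) ≠ 0) := by
  -- `2^{M-1} P ≠ 0`, `2^{M-1} τP ≠ 0`, `2^{M-1} (P + τP) ≠ 0` when `M ≠ 0`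
  have hndvd : ∀ {M : ℕ}, M ≠ 0 → ¬ (2 : ℤ) ^ M ∣ (2 : ℤ) ^ (M - 1) := fun {M} hM h ↦ by
    have h1 : (2 : ℤ) ^ (M - 1) < (2 : ℤ) ^ M := pow_lt_pow_right₀ (by norm_num) (by omega)
    exact absurd (Int.le_of_dvd (by positivity) h) (not_le.mpr h1)
  have hP1 : M ≠ 0 → (2 : ℤ) ^ (M - 1) • P ≠ 0 := fun hM h ↦ by
    have := (hfree ((2 : ℤ) ^ (M - 1)) 0 (by rw [h, zero_smul, add_zero])).1
    exact hndvd hM this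
  have hτP1 : M ≠ 0 → (2 : ℤ) ^ (M - 1) • τ P ≠ 0 := fun hM h ↦ by
    have := (hfree 0 ((2 : ℤ) ^ (M - 1)) (by rw [h, zero_smul, zero_add])).2
    exact hndvd hM this
  have hsum1 : M ≠ 0 → (2 : ℤ) ^ (M - 1) • (τ P + P) ≠ 0 := fun hM h ↦ by
    have := (hfree ((2 : ℤ) ^ (M - 1)) ((2 : ℤ) ^ (M - 1)) (by rw [smul_add] at h; rw [add_comm]; exact h)).1
    exact hndvd hM this
  have hτPM : (2 : ℤ) ^ M • τ P = 0 := by rw [← map_zsmul, hPM, map_zero]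
  -- a choice of representative in each `π`-orbit: `i` is chosen iff `enc i ≤ enc (π i)`
  set enc : ι → ℕ := fun i ↦ (Fintype.equivFin ι i : ℕ) with henc
  have henc_inj : Function.Injective enc := fun i j h ↦
    (Fintype.equivFin ι).injective (Fin.ext h)
  set x : ι → T := fun i ↦ if enc i ≤ enc (π i) then (2 : ℤ) ^ (M - N i) • P else 0 with hx
  have hNM : ∀ i, N i ≤ M := fun i ↦ (hNe i).trans (heM i)
  refine ⟨x, fun i ↦ ?_, fun i ↦ ?_⟩
  · -- `2^{e i} x i = 0`
    by_cases h : enc i ≤ enc (π i)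
    · simp only [hx, h, if_true]
      rw [smul_smul, ← pow_add, show e i + (M - N i) = M + (e i - N i) by
        have := hNe i; have := heM i; omega, pow_add, mul_comm, mul_smul, hPM, smul_zero]
    · simp only [hx, h, if_false, smul_zero]
  · by_cases hfix : π i = i
    · -- a fixed point: value `2^{M-N}(τP + P)`
      have hle : enc i ≤ enc (π i) := by rw [hfix]
      have hval : τ (x (π i)) + x i = (2 : ℤ) ^ (M - N i) • (τ P + P) := by
        simp only [hx, hfix, le_refl, if_true, map_zsmul, smul_add]
      rw [hval]
      refine zsmul_pow_sub_order (hNM i) ?_ fun hN0 ↦ hsum1 (by have := hNM i; omega)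
      rw [smul_add, hτPM, hPM, add_zero]
    · by_cases h : enc i ≤ enc (π i)
      · -- `i` is the representative: `x (π i) = 0`, value `2^{M-N} P`
        have hne : ¬ enc (π i) ≤ enc (π (π i)) := by
          rw [hπ]
          intro h'
          exact hfix (henc_inj (le_antisymm h' h))
        have hval : τ (x (π i)) + x i = (2 : ℤ) ^ (M - N i) • P := by
          simp only [hx, h, hne, if_true, if_false, map_zero, zero_add]
        rw [hval]
        exact zsmul_pow_sub_order (hNM i) hPM fun hN0 ↦ hP1 (by have := hNM i; omega)
      · -- `π i` is the representative: `x i = 0`, value `2^{M-N} τP`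
        have hle : enc (π i) ≤ enc (π (π i)) := by rw [hπ]; omega
        have hval : τ (x (π i)) + x i = (2 : ℤ) ^ (M - N i) • τ P := by
          simp only [hx, h, hle, if_true, if_false, add_zero, map_zsmul, hNπ]
        rw [hval]
        exact zsmul_pow_sub_order (hNM i) hτPM fun hN0 ↦ hτP1 (by have := hNM i; omega)

end StepB

end Summit.BirchSwinnertonDyer.BirchSwinnertonDyer.Theorems.GenusExact

end
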